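import Summits.QuantumFields.YangMills.Theorems.BalabanUVNodesN07UniformFluxHolonomy
import Summits.QuantumFields.YangMills.Theorems.BalabanUVNodesN07UniformFluxCritical
import Summits.QuantumFields.YangMills.Theorems.BalabanUVNodesN07FaceDatumGeometry
import Literature.MathematicalPhysics.QuantumFieldTheory.Balaban1983to89.B16Thm1BaseAtRecord11

/-!
# BalabanUVNodes ∕ N07 ([Balaban1985Variational] Prop. 8 p. 304; LOCATED-M5 KERNEL CERTIFICATE, part 22c) — THE UN-STEPPED READING
# `Node00.Prop8RegSepPrinted F N B₃ a₀ a₁` (v1.0, WITHOUT the binder `1 ≤ k`) IS REFUTABLE FOR EVERY `B₃` (`0 < a₀`, `0 < a₁`, `N ≥ 2`): at `k = 0` the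
# tree's fibre is unconstrained and the uniform-flux lattice Yang–Mills solution is a critical configuration in the class violating (8)

Cell `pub-ymgap`, seat `pub-ymgap-dag-n07-e` generation 8 (R141 (C), DAG node N07 = [15]; ROW P11 negative lane; INBOX LOCATED-M5 l.18464 (ref-G CONCUR), INTENT-22).
`--kind proof --supports stmt-QuantumFields-20293 --as helper`.  THEOREMS ONLY (0 `def`, 0 `sorry`).

WHAT THIS FILE DOES.  §1: for `N ≥ 2`, `m ≥ 2` an element `D = diag(ζ, ζ̄, 1, …, 1) ∈ SU(N)`, `ζ = exp(2πi∕m)`, with `D ^ m = 1` and `0 < dist1 D ≤ 2π∕m`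
(`exists_su_pow_eq_one_dist1`).  §2: ★★★ `not_prop8RegSepPrinted (hN : 2 ≤ N) (ha₀ : 0 < a₀) (ha₁ : 0 < a₁) : ¬ Node00.Prop8RegSepPrinted F N B₃ a₀ a₁` for EVERY `B₃`:
instantiate the fact at `k = 0` (the tree's (2.18) index with every `Ω_j = ∅`, `Sect2.SeqSeparated` vacuous), on a lattice `F.P K` fine enough that `n = sitesPerDir 0` has
`2π∕n² ≤ a₀∕16`, with §1's `D` (`m = n²`), part 22a's uniform-flux configuration `U b = D ^ e b` (EVERY `(0,1)`-plaquette has holonomy `D`, all others `1`), `ε₀ = a₀`,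
`δ₀ = a₁` if `B₃ ≤ 0` else `min(a₁, dist1 D∕B₃)`, datum `W = 1` ((7)₀ trivially): `U` is in the class (6) at `a₀` (plaquettes `≤ dist1 D < a₀`; co-divergence `≤ 8·dist1 D < a₀` by
part A1 `norm_coDivSum_le`), on the fibre of `W` (determining set EMPTY at `k = 0`, `B16Thm1BaseAtRecord11.agreeOn_genSet_seq_zero`), CRITICAL there (part 22b
`isCritOnFibre_of_planeFlux`), yet (8)₀ demands `dist1 D < B₃δ₀ ≤ dist1 D` at the `(0,1)`-plaquette at the origin.  §2 also records `prop8RegSepPrinted_only_degenerate`.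

WHAT IT MEANS (numbers, not adjectives): the v1.0 sentence (p514709) quantifies `∀ k` and at `k = 0` reads «every critical point of (5) in the class is (8)-small» — false on
every `SU(N)`, `N ≥ 2`, by a flux quantum `2 sin(π∕n²)`; the located repair is this seat's v1.1 `Prop8RegSepStep` ∕ 20d `Prop8RegSepTopStep` (binder `1 ≤ k`: print's Prop. 8 is a
statement about a genuine step, where the determining set pins the configuration), which this file does NOT touch.  FILE 11's `variationalThm1RegSepCo7_of_prop8` (keyed on v1.0)
thereby has an uninhabited antecedent at `0 < a₀, 0 < a₁`; its `…_of_prop8Step` twins (p521373, p525586) are the live suppliers.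

HONEST FRAMING: a kernel certificate about a TREE-typed sentence; [15] Prop. 8 itself is NOT refuted and NOT claimed; nothing of Bałaban asserted; K0 neither discharged nor
refuted; N07 NOT discharged (5∕27); one finite `T⁴` programme at fixed ε — NOT continuum ∕ ℝ⁴ ∕ OS ∕ mass gap ∕ Clay.

DEPENDENCES (by name): this seat's 22a `N07UniformFlux.(plaqHol_flux_eq, plaqHol_flux_eq_or, plaqHol_flux_plane, plaqHol_eq_zpow)`, 22b
`N07UniformFluxCritical.isCritOnFibre_of_planeFlux`, A1 `N07FaceDatumAverage.norm_coDivSum_le`, v1.0 `Node00.Prop8RegSepPrinted` (p514709), `B16Thm1BaseAtRecord11.agreeOn_genSet_seq_zero`,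
`T4Family.(sitesPerDir_tendsto, P_d)`, Mathlib (`Complex.isPrimitiveRoot_exp`, `Real.norm_exp_I_mul_ofReal_sub_one_le`, `Matrix.l2_opNorm_diagonal`).
-/

noncomputable section

namespace Summit.QuantumFields.YangMills.BalabanUVNodes.N07Prop8LevelZeroObstruction

open Literature.MathematicalPhysics.QuantumFieldTheory.Balaban1983to89
open Literature.MathematicalPhysics.QuantumFieldTheory.Balaban1983to89.T4Continuum (T4Family)
open Literature.MathematicalPhysics.QuantumFieldTheory.Balaban1983to89.Node00
open Literature.MathematicalPhysics.QuantumFieldTheory.Balaban1983to89.B15DeterminingSets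
open Summit.QuantumFields.YangMills.BalabanUVNodes
open scoped Matrix.Norms.L2Operator
open Filter

/-! ## §1  A root of unity in `SU(N)` close to the identity -/

section RootOfUnity

variable {N : ℕ} [NeZero N]

/-- **A ROOT OF UNITY IN `SU(N)` NEAR `1`**: for `N ≥ 2` and `m ≥ 2`, `D = diag(ζ, ζ̄, 1, …, 1)` with `ζ = exp(2πi∕m)` has `D ^ m = 1`, `0 < dist1 D ≤ 2π∕m`. [folklore] -/
theorem exists_su_pow_eq_one_dist1 (hN : 2 ≤ N) {m : ℕ} (hm : 2 ≤ m) :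
    ∃ D : SU N, D ^ m = 1 ∧ 0 < dist1 D ∧ dist1 D ≤ 2 * Real.pi / m := by
  -- the phase `ζ = exp(2πi/m)`
  obtain ⟨ζ, hζ⟩ : ∃ z : ℂ, Complex.exp (2 * Real.pi * Complex.I / m) = z := ⟨_, rfl⟩
  have hprim : IsPrimitiveRoot ζ m := hζ ▸ Complex.isPrimitiveRoot_exp m (by omega)
  have hζm : ζ ^ m = 1 := hprim.pow_eq_one
  have hζ1 : ζ ≠ 1 := hprim.ne_one hm
  have hζn : ‖ζ‖ = 1 := hprim.norm'_eq_one (by omega)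
  have hζt : ‖ζ - 1‖ ≤ 2 * Real.pi / m := by
    have h := Real.norm_exp_I_mul_ofReal_sub_one_le (x := 2 * Real.pi / m)
    have he : Complex.exp (Complex.I * ((2 * Real.pi / m : ℝ) : ℂ)) = ζ := by
      rw [← hζ]; congr 1; push_cast; ring
    rw [he, Real.norm_eq_abs, abs_of_nonneg (by positivity)] at h
    exact h
  have hζt' : ‖starRingEnd ℂ ζ - 1‖ ≤ 2 * Real.pi / m := by
    rw [← map_one (starRingEnd ℂ), ← map_sub, Complex.norm_conj]; exact hζt
  -- the phase vector `(ζ, ζ̄, 1, …, 1)`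
  obtain ⟨n, rfl⟩ : ∃ n, N = n + 2 := ⟨N - 2, by omega⟩
  obtain ⟨v, hv⟩ : ∃ w : Fin (n + 2) → ℂ, Fin.cons ζ (Fin.cons (starRingEnd ℂ ζ) fun _ => (1 : ℂ)) = w := ⟨_, rfl⟩
  have hv0 : v 0 = ζ := by rw [← hv]; rfl
  have hv1 : v 1 = starRingEnd ℂ ζ := by rw [← hv]; rfl
  have hvss : ∀ i : Fin n, v i.succ.succ = 1 := fun i => by rw [← hv]; rfl
  have hv_norm : ∀ i, ‖v i‖ = 1 := by
    intro i
    refine Fin.cases ?_ (fun j => ?_) i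
    · rw [hv0, hζn]
    · refine Fin.cases ?_ (fun k => ?_) j
      · show ‖v 1‖ = 1
        rw [hv1, Complex.norm_conj, hζn]
      · rw [hvss, norm_one]
  have hv_pow : ∀ i, v i ^ m = 1 := by
    intro i
    refine Fin.cases ?_ (fun j => ?_) i
    · rw [hv0, hζm]
    · refine Fin.cases ?_ (fun k => ?_) j
      · show v 1 ^ m = 1
        rw [hv1, ← map_pow, hζm, map_one]
      · rw [hvss, one_pow]
  have hv_sub : ∀ i, ‖v i - 1‖ ≤ 2 * Real.pi / m := by
    intro i
    refine Fin.cases ?_ (fun j => ?_) i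
    · rw [hv0]; exact hζt
    · refine Fin.cases ?_ (fun k => ?_) j
      · show ‖v 1 - 1‖ ≤ _
        rw [hv1]; exact hζt'
      · rw [hvss, sub_self, norm_zero]; positivity
  have hv_prod : ∏ i, v i = 1 := by
    rw [Fin.prod_univ_succ, Fin.prod_univ_succ, hv0]
    have h2 : ∏ i : Fin n, v i.succ.succ = 1 := Finset.prod_eq_one fun i _ => hvss i
    rw [h2, mul_one]
    show ζ * v 1 = 1
    rw [hv1, Complex.mul_conj, Complex.normSq_eq_norm_sq, hζn]; simp
  -- the matrix `diag v ∈ SU(n+2)`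
  have hunit : Matrix.diagonal v ∈ Matrix.unitaryGroup (Fin (n + 2)) ℂ := by
    rw [Matrix.mem_unitaryGroup_iff, Matrix.star_eq_conjTranspose, Matrix.diagonal_conjTranspose, Matrix.diagonal_mul_diagonal,
      ← Matrix.diagonal_one]
    congr 1
    funext i
    have h := hv_norm i
    rw [Pi.star_apply, Complex.star_def, Complex.mul_conj, Complex.normSq_eq_norm_sq, h]
    simp
  have hsu : Matrix.diagonal v ∈ Matrix.specialUnitaryGroup (Fin (n + 2)) ℂ := by
    rw [Matrix.mem_specialUnitaryGroup_iff]
    exact ⟨hunit, by rw [Matrix.det_diagonal, hv_prod]⟩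
  refine ⟨⟨Matrix.diagonal v, hsu⟩, ?_, ?_, ?_⟩
  · apply Subtype.ext
    rw [SubmonoidClass.coe_pow, OneMemClass.coe_one]
    show Matrix.diagonal v ^ m = 1
    rw [Matrix.diagonal_pow, ← Matrix.diagonal_one]
    congr 1
    funext i
    exact hv_pow i
  · show 0 < ‖(Matrix.diagonal v : Matrix (Fin (n + 2)) (Fin (n + 2)) ℂ) - 1‖
    rw [← Matrix.diagonal_one, Matrix.diagonal_sub, Matrix.l2_opNorm_diagonal]
    have h := norm_le_pi_norm (v - 1) 0
    have h0 : ‖(v - 1) 0‖ = ‖ζ - 1‖ := by rw [Pi.sub_apply, Pi.one_apply, hv0]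
    have hpos : 0 < ‖ζ - 1‖ := norm_pos_iff.mpr (sub_ne_zero.mpr hζ1)
    rw [h0] at h
    exact hpos.trans_le h
  · show ‖(Matrix.diagonal v : Matrix (Fin (n + 2)) (Fin (n + 2)) ℂ) - 1‖ ≤ 2 * Real.pi / m
    rw [← Matrix.diagonal_one, Matrix.diagonal_sub, Matrix.l2_opNorm_diagonal]
    exact (pi_norm_le_iff_of_nonneg (by positivity)).mpr fun i => hv_sub i

end RootOfUnity

/-! ## §2  The certificate -/

section Certificate

variable (F : T4Family) {N : ℕ} [NeZero N]

/-- ★★★ **`¬ Node00.Prop8RegSepPrinted F N B₃ a₀ a₁` FOR EVERY `B₃` ON EVERY `SU(N)`, `N ≥ 2`** (`0 < a₀`, `0 < a₁`): THE LOCATED-M5 KERNEL CERTIFICATE.  At `k = 0` the v1.0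
sentence asks every critical configuration of (5) in the class (6) to be (8)-small; the uniform-flux lattice Yang–Mills solution on a fine enough `F.P K` is critical, in the
class, and has constant field strength `D ≠ 1` on the `(0,1)`-plane.  (The repaired STEP forms `Prop8RegSepStep` ∕ `Prop8RegSepTopStep`, binder `1 ≤ k`, are untouched.)
[cite: Balaban1985Variational, (5)–(8) p.278–279, Prop. 8 p.304; Balaban1985RegularSpaces, (1.7)–(1.9) p.77; Balaban1988Convergent, (2.12) p.256] -/
theorem not_prop8RegSepPrinted (hN : 2 ≤ N) {B₃ a₀ a₁ : ℝ} (ha₀ : 0 < a₀) (ha₁ : 0 < a₁) : ¬ Prop8RegSepPrinted F N B₃ a₀ a₁ := by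
  intro h8
  -- (1) a lattice fine enough
  obtain ⟨K, hK⟩ : ∃ K, ⌈32 * Real.pi / a₀⌉₊ + 2 ≤ (F.P K).sitesPerDir 0 := by
    obtain ⟨K0, hK0⟩ := tendsto_atTop_atTop.mp F.sitesPerDir_tendsto (⌈32 * Real.pi / a₀⌉₊ + 2)
    exact ⟨K0, hK0 K0 le_rfl⟩
  obtain ⟨nK, hnK⟩ : ∃ n : ℕ, (F.P K).sitesPerDir 0 = n := ⟨_, rfl⟩
  rw [hnK] at hK
  have hnK2 : 2 ≤ nK := by omega
  have hceil : (⌈32 * Real.pi / a₀⌉₊ : ℝ) ≤ nK := by exact_mod_cast (by omega : ⌈32 * Real.pi / a₀⌉₊ ≤ nK)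
  have hnKr : 32 * Real.pi / a₀ ≤ (nK : ℝ) := (Nat.le_ceil _).trans hceil
  -- (2) the flux quantum `D`, `D ^ (nK²) = 1`, `0 < dist1 D ≤ 2π/nK² ≤ a₀/16`
  obtain ⟨D, hDm, hDpos, hDle⟩ := exists_su_pow_eq_one_dist1 (N := N) hN (m := nK ^ 2) (by nlinarith)
  obtain ⟨t, ht⟩ : ∃ r : ℝ, dist1 D = r := ⟨_, rfl⟩
  rw [ht] at hDpos hDle
  have ht16 : t ≤ a₀ / 16 := by
    have h1 : (nK : ℝ) ≤ ((nK ^ 2 : ℕ) : ℝ) := by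
      have : (1 : ℝ) ≤ nK := by exact_mod_cast (by omega : 1 ≤ nK)
      push_cast; nlinarith
    have h2 : 32 * Real.pi / a₀ ≤ ((nK ^ 2 : ℕ) : ℝ) := hnKr.trans h1
    have hπ : 0 < Real.pi := Real.pi_pos
    calc t ≤ 2 * Real.pi / ((nK ^ 2 : ℕ) : ℝ) := hDle
      _ ≤ 2 * Real.pi / (32 * Real.pi / a₀) := div_le_div_of_nonneg_left (by positivity) (by positivity) h2
      _ = a₀ / 16 := by field_simp; ring
  -- (3) the plane, the flux exponents, the configuration
  obtain ⟨μ0, hμ0⟩ : ∃ μ : Fin (F.P K).d, μ.val = 0 := ⟨⟨0, by rw [T4Family.P_d]; norm_num⟩, rfl⟩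
  obtain ⟨ν0, hν0⟩ : ∃ ν : Fin (F.P K).d, ν.val = 1 := ⟨⟨1, by rw [T4Family.P_d]; norm_num⟩, rfl⟩
  have hμν : μ0 < ν0 := Fin.lt_def.mpr (by rw [hμ0, hν0]; exact Nat.zero_lt_one)
  obtain ⟨e, he⟩ : ∃ e : PBond (F.P K) 0 → ℤ, ∀ b, e b = if b.dir = ν0 then ((b.src μ0).val : ℤ)
      else if b.dir = μ0 ∧ (b.src μ0).val = (F.P K).sitesPerDir 0 - 1 then -(((F.P K).sitesPerDir 0 : ℤ) * (b.src ν0).val) else 0 :=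
    ⟨_, fun _ => rfl⟩
  obtain ⟨U, hU⟩ : ∃ U : GaugeField (F.P K) 0 (SU N), ∀ b, U b = D ^ e b := ⟨fun b => D ^ e b, fun _ => rfl⟩
  have hDm' : D ^ ((F.P K).sitesPerDir 0 ^ 2) = 1 := by rw [hnK]; exact hDm
  have hH : ∀ p, GaugeField.plaqHol U p = if p.μ = μ0 ∧ p.ν = ν0 then D else 1 := N07UniformFlux.plaqHol_flux_eq μ0 ν0 hμν hDm' he hU
  have hdist : ∀ q, dist1 (GaugeField.plaqHol U q) ≤ t := fun q => by
    rcases N07UniformFlux.plaqHol_flux_eq_or μ0 ν0 hμν hDm' he hU q with h | h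
    · rw [h, ht]
    · rw [h, GaugeGroup.dist1_one]; exact hDpos.le
  have hcomm : ∀ b p, Commute (U b) (GaugeField.plaqHol U p) := fun b p => by
    rw [hU b, N07UniformFlux.plaqHol_eq_zpow D e hU p]; exact (Commute.refl D).zpow_zpow _ _
  -- (4) the k = 0 index, the numerics, the thresholds, the datum
  obtain ⟨ν7, hν7⟩ : ∃ ν : Stage7Numerics, ν.M₁ = 1 := ⟨⟨1, 1, 1, 1, 1, 0, 1, 1⟩, rfl⟩
  obtain ⟨s, -⟩ : ∃ _ : SeqOfRecord F ν7 1 (fun _ => 1) K 0, True :=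
    ⟨⟨fun _ => ∅, fun _ => ∅,
      ⟨fun j _ hj => absurd hj (by omega), fun j _ hj => absurd hj (by omega), fun j _ hj => absurd hj (by omega),
        fun j _ hj => absurd hj (by omega)⟩,
      fun _ _ => rfl, fun _ _ => rfl⟩, trivial⟩
  have hsep : Sect2.SeqSeparated ν7.M₁ s := fun n _ hn => absurd hn (Nat.not_lt_zero n)
  obtain ⟨δ0, hδ0⟩ : ∃ r : ℝ, (if B₃ ≤ 0 then a₁ else min a₁ (t / B₃)) = r := ⟨_, rfl⟩
  have hδ0pos : 0 < δ0 := by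
    rw [← hδ0]; split_ifs with hB
    · exact ha₁
    · exact lt_min ha₁ (div_pos hDpos (lt_of_not_ge hB))
  have hδ0le : δ0 ≤ a₁ := by
    rw [← hδ0]; split_ifs with hB
    · exact le_rfl
    · exact min_le_left _ _
  have hBδ : B₃ * δ0 ≤ t := by
    rw [← hδ0]; split_ifs with hB
    · exact (mul_nonpos_of_nonpos_of_nonneg hB ha₁.le).trans hDpos.le
    · have hB' : 0 < B₃ := lt_of_not_ge hB
      calc B₃ * min a₁ (t / B₃) ≤ B₃ * (t / B₃) := mul_le_mul_of_nonneg_left (min_le_right _ _) hB'.le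
        _ = t := mul_div_cancel₀ t hB'.ne'
  have hBε : B₃ * δ0 ≤ a₀ := hBδ.trans (ht16.trans (by linarith))
  have heta : (F.P K).eta 0 = 1 := pow_zero _
  have h1plaq : ∀ p : Plaq (F.P K) 0, dist1 (GaugeField.plaqHol (1 : GaugeField (F.P K) 0 (SU N)) p) = 0 := fun p => by
    show dist1 ((1 : SU N) * 1 * 1⁻¹ * 1⁻¹) = 0
    rw [inv_one, mul_one, mul_one, mul_one, GaugeGroup.dist1_one]
  have h7 : Sect2.DataSmall7P (avOfRecord F N K) s.Ω 0 (fun _ => δ0) (1 : MSField (F.P K) (SU N)) :=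
    ⟨fun p _ => by rw [Pi.one_apply, h1plaq p]; exact hδ0pos, fun m hm => absurd hm (by omega)⟩
  -- (5) class membership, fibre, criticality
  have h17 : ∀ n, n ≤ 0 → PlaqSmallOn (omegaPlaqs s.Ω n) (a₀ * (F.P K).eta n ^ 2) U := by
    intro n hn p _
    obtain rfl := Nat.le_zero.mp hn
    rw [heta, one_pow, mul_one]
    exact (hdist p).trans_lt (by linarith)
  have hd4 : ((F.P K).d : ℝ) = 4 := by rw [T4Family.P_d]; norm_num
  have h19 : Sect2.CoDivClassOn s.Ω 0 a₀ U := by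
    intro j hj b _
    obtain rfl := Nat.le_zero.mp hj
    rw [heta, one_pow, mul_one]
    have h := N07FaceDatumAverage.norm_coDivSum_le U hDpos.le hdist b.src b.dir
    rw [hd4] at h
    linarith
  have hagree : AgreeOn (genSet s.Ω 0) (avgFamily (avOfRecord F N K) U) 1 :=
    B16Thm1BaseAtRecord11.agreeOn_genSet_seq_zero F N s _ _
  have hcrit : IsCritOnFibre F N K (genSet s.Ω 0) 1 U := N07UniformFluxCritical.isCritOnFibre_of_planeFlux hμν hcomm hH _ _
  -- (6) the fact at this instance, contradicted at the `(0,1)`-plaquette at the origin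
  have h := h8 ν7 1 (fun _ => 1) K 0 s hsep a₀ (fun _ => δ0) (fun n _ => ⟨hδ0pos, hδ0le, hBε⟩)
    (fun n hn => absurd hn (Nat.not_lt_zero n)) (fun n hn => absurd hn (Nat.not_lt_zero n)) le_rfl 1 h7 U h17 h19 hagree hcrit
  have h8' := h.1 0 le_rfl ⟨default, μ0, ν0, hμν⟩ (by rw [omegaPlaqs_zero]; exact Set.mem_univ _)
  rw [N07UniformFlux.plaqHol_flux_plane μ0 ν0 hμν hDm' he hU, ht, heta, one_pow, mul_one] at h8'
  linarith

/-- **The v1.0 sentence holds only degenerately** (`N ≥ 2`): `Prop8RegSepPrinted F N B₃ a₀ a₁ → a₀ ≤ 0 ∨ a₁ ≤ 0`. [cite: Balaban1985Variational, Prop. 8 p.304 (bookkeeping)] -/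
theorem prop8RegSepPrinted_only_degenerate (hN : 2 ≤ N) {B₃ a₀ a₁ : ℝ} (h : Prop8RegSepPrinted F N B₃ a₀ a₁) : a₀ ≤ 0 ∨ a₁ ≤ 0 := by
  rcases le_or_gt a₀ 0 with h0 | h0
  · exact Or.inl h0
  rcases le_or_gt a₁ 0 with h1 | h1
  · exact Or.inr h1
  exact absurd h (not_prop8RegSepPrinted F hN h0 h1)

end Certificate

end Summit.QuantumFields.YangMills.BalabanUVNodes.N07Prop8LevelZeroObstruction

end
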